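import Summits.ValiantsHypothesis.ValiantsHypothesis.Theorems.KPlusLogSqLawTridiagonalRealStaticUnitRows
import Summits.ValiantsHypothesis.ValiantsHypothesis.Theorems.KPlusLogSqLawTridiagonalRealStaticUnitSmall

/-!
# Route «KPlusLogSqLaw», crux `WeakLifting` (stmt-ValiantsHypothesis-19561) — REAL side of the tridiagonal sector:
# the UNIT-COEFFICIENT sub-sector, ALL SIZES — the TRIPLE-BLOCK LAWS: an infinite family of EMPTY chambers and of EXACTLY-ONE chambers

HONEST FRAMING.  Helper theorems (`--supports stmt-ValiantsHypothesis-19561 --as helper`), seat val-sym-lift-p1 (g17), cell `pub-symmetroid`,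
2026-08-28.  Currency `StaticTridiagonalRealPotential.pathDet (fun _ => 1) d (fun _ => 1) f m` (diagonal `X^{d_t}`, links `X^{f_t}`, all coefficients
`1`); edge slopes `L_t = 2f_t − d_t − d_{t+1}`.  Cut the path into consecutive TRIPLE BLOCKS `{3i, 3i+1, 3i+2}`; block `i` is DESCENDING when its two
inner edges have slopes `L_{3i} > 0 > L_{3i+1}`; the JOINT edges `3i+2` between blocks are unconstrained.  Proved here, for EVERY number of blocks and
ALL exponent data (induction on the blocks through the continuant splitting identities `eval_unit_split_two/three` at the last joint):
* `tripleBlock_signs` — SIGN LAW: if blocks `0..j` are descending then `(−1)^{j+1}·D_{3j+3}(x) > 0` for every `x > 0`, `x ≠ 1`; and if blocks `0..j−1`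
  are descending and the first edge of block `j` is ascending (`L_{3j} > 0`) then `D_{3j+2}` has the sign `(−1)^j` on `(0,1)` and `(−1)^{j+1}` on
  `(1,∞)` (the size-`(3j+2)` designs carry the resonance zero `x = 1`, `…UnitSmall.isRoot_one_unit_iff`);
* **TRIPLE-BLOCK EMPTY CHAMBER LAW** (`card_posRoots_unit_tripleBlock_eq_zero`): a unit design of size `3(j+1)` whose blocks are all descending —
  slope signs `(+, −, *, +, −, *, …, +, −)`, joints `*` arbitrary — has NO positive determinant zero (size `6`: the empty chamber `+ − ? + −` of
  `…UnitSixChambers`; sizes `9, 12, …`: new);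
* **TRIPLE-BLOCK EXACTLY-ONE LAW** (`card_posRoots_unit_tripleBlockTrunc_eq_one`): a unit design of size `3j+2` with blocks `0..j−1` descending and
  `L_{3j} > 0` — slope signs `(+, −, *, …, +, −, *, +)` — has EXACTLY ONE positive zero, the resonance `x = 1`.
By `x ↦ 1/x` the mirrored patterns `(−, +, *, …)` behave the same (not restated).  Located first (seat tool scanpat.c: patterns `+−?+−`, `+−?+−?+−`,
`+−?+−?+−?+−` read `0` zeros in every sample), then proved.  Nothing here is an upper law for the register (α NO MOVER); nothing bears on
`WeakLifting` / `TropicalB` (stmt-19771) in their windows, Conjecture B, the Door-A registers, `MatrixDescartes` (stmt-18050) or VP ≠ VNP.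
[this seat; folklore: three-term recurrence / splitting of continuants]
-/

-- `Summit.ValiantsHypothesis.ValiantsHypothesis.…` repeats a component by the D-0017 layout (single-conjunct summit); the name is mandated.
set_option linter.dupNamespace false
set_option autoImplicit false

namespace Summit.ValiantsHypothesis.ValiantsHypothesis.Theorems.KPlusLogSqLaw
namespace StaticTridiagonalRealUnit

open Polynomial Finset
open Summit.ValiantsHypothesis.ValiantsHypothesis.Theorems.KPlusLogSqLaw.StaticTridiagonalRealPotential (pathDet)

variable (d : ℕ → ℕ) (f : ℕ → ℕ)

/-! ### Splitting the continuant at the last joint -/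

/-- split off a terminal 2-block: `D_{n+3} = (x^{d_{n+1}+d_{n+2}} − x^{2f_{n+1}})·D_{n+1} − x^{2f_n + d_{n+2}}·D_n`. [folklore] -/
theorem eval_unit_split_two (x : ℝ) (n : ℕ) :
    (pathDet (fun _ => (1 : ℝ)) d (fun _ => (1 : ℝ)) f (n + 3)).eval x =
      (x ^ (d (n + 1) + d (n + 2)) - x ^ (2 * f (n + 1))) * (pathDet (fun _ => (1 : ℝ)) d (fun _ => (1 : ℝ)) f (n + 1)).eval x -
        x ^ (2 * f n + d (n + 2)) * (pathDet (fun _ => (1 : ℝ)) d (fun _ => (1 : ℝ)) f n).eval x := by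
  have e2 := eval_unit_add_two d f x n
  have e3 := eval_unit_add_two d f x (n + 1)
  rw [show n + 3 = n + 1 + 2 from rfl, e3, show n + 1 + 1 = n + 2 from rfl, e2]
  ring

/-- split off a terminal 3-block: `D_{n+4} = T·D_{n+1} − x^{2f_n}·(x^{d_{n+2}+d_{n+3}} − x^{2f_{n+2}})·D_n` with the 3-block determinant
`T = x^{d_{n+1}+d_{n+2}+d_{n+3}} − x^{2f_{n+1}+d_{n+3}} − x^{d_{n+1}+2f_{n+2}}`. [folklore] -/
theorem eval_unit_split_three (x : ℝ) (n : ℕ) :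
    (pathDet (fun _ => (1 : ℝ)) d (fun _ => (1 : ℝ)) f (n + 4)).eval x =
      (x ^ (d (n + 1) + d (n + 2) + d (n + 3)) - x ^ (2 * f (n + 1) + d (n + 3)) - x ^ (d (n + 1) + 2 * f (n + 2))) *
          (pathDet (fun _ => (1 : ℝ)) d (fun _ => (1 : ℝ)) f (n + 1)).eval x -
        x ^ (2 * f n) * (x ^ (d (n + 2) + d (n + 3)) - x ^ (2 * f (n + 2))) *
          (pathDet (fun _ => (1 : ℝ)) d (fun _ => (1 : ℝ)) f n).eval x := by
  have e2 := eval_unit_add_two d f x n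
  have e3 := eval_unit_add_two d f x (n + 1)
  have e4 := eval_unit_add_two d f x (n + 2)
  rw [show n + 4 = n + 2 + 2 from rfl, e4, show n + 2 + 1 = n + 1 + 2 from rfl, e3, show n + 1 + 1 = n + 2 from rfl, e2]
  ring

/-! ### Signs of the block factors -/

/-- an ascending 2-block `x^a − x^b` (`a < b`): positive on `(0,1)`, negative on `(1,∞)`. [elementary] -/
theorem twoBlock_sign {x : ℝ} (hx : 0 < x) {a b : ℕ} (hab : a < b) :
    (x < 1 → 0 < x ^ a - x ^ b) ∧ (1 < x → x ^ a - x ^ b < 0) :=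
  ⟨fun h1 => sub_pos.2 (pow_lt_pow_right_of_lt_one₀ hx h1 hab), fun h1 => sub_neg.2 (pow_lt_pow_right₀ h1 hab)⟩

/-- a descending 3-block `x^a − x^b − x^c` with `c < a < b` is negative at every `x > 0`. [elementary] -/
theorem threeBlock_neg {x : ℝ} (hx : 0 < x) {a b c : ℕ} (hab : a < b) (hca : c < a) : x ^ a - x ^ b - x ^ c < 0 := by
  have pb := pow_pos hx b
  have pc := pow_pos hx c
  rcases lt_or_ge x 1 with h1 | h1
  · have : x ^ a < x ^ c := pow_lt_pow_right_of_lt_one₀ hx h1 hca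
    linarith
  · have : x ^ a ≤ x ^ b := pow_le_pow_right₀ h1 hab.le
    linarith

/-! ### The sign law by induction on the blocks -/

/-- **SIGN LAW for triple-block designs.**  Blocks `0..j` descending ⇒ `(−1)^{j+1} D_{3j+3} > 0` off `x = 1`; blocks `0..j−1` descending and
`L_{3j} > 0` ⇒ `D_{3j+2}` has sign `(−1)^j` on `(0,1)` and `(−1)^{j+1}` on `(1,∞)`. [this file] -/
theorem tripleBlock_signs (j : ℕ) {x : ℝ} (hx : 0 < x) :
    ((∀ i, i ≤ j → d (3 * i) + d (3 * i + 1) < 2 * f (3 * i) ∧ 2 * f (3 * i + 1) < d (3 * i + 1) + d (3 * i + 2)) →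
        x ≠ 1 → 0 < (-1 : ℝ) ^ (j + 1) * (pathDet (fun _ => (1 : ℝ)) d (fun _ => (1 : ℝ)) f (3 * j + 3)).eval x) ∧
      ((∀ i, i < j → d (3 * i) + d (3 * i + 1) < 2 * f (3 * i) ∧ 2 * f (3 * i + 1) < d (3 * i + 1) + d (3 * i + 2)) →
        d (3 * j) + d (3 * j + 1) < 2 * f (3 * j) →
          (x < 1 → 0 < (-1 : ℝ) ^ j * (pathDet (fun _ => (1 : ℝ)) d (fun _ => (1 : ℝ)) f (3 * j + 2)).eval x) ∧
          (1 < x → 0 < (-1 : ℝ) ^ (j + 1) * (pathDet (fun _ => (1 : ℝ)) d (fun _ => (1 : ℝ)) f (3 * j + 2)).eval x)) := by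
  induction j with
  | zero =>
    obtain ⟨e0, e1⟩ := eval_unit_zero_one d f x
    have e2 := eval_unit_add_two d f x 0
    have e3 := eval_unit_add_two d f x 1
    simp only [zero_add] at e2
    refine ⟨fun hB hx1 => ?_, fun _ hE => ?_⟩
    · obtain ⟨h0, h1⟩ := hB 0 le_rfl
      simp only [Nat.mul_zero, zero_add] at h0 h1 ⊢
      rw [show (3 : ℕ) = 1 + 2 from rfl, e3, show (1 : ℕ) + 1 = 2 from rfl, e2, e1, e0]
      have key : x ^ d 2 * (x ^ d 1 * x ^ d 0 - x ^ (2 * f 0) * 1) - x ^ (2 * f 1) * x ^ d 0 =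
          x ^ (d 0 + d 1 + d 2) - x ^ (2 * f 0 + d 2) - x ^ (d 0 + 2 * f 1) := by ring
      rw [key]
      have := threeBlock_neg hx (a := d 0 + d 1 + d 2) (b := 2 * f 0 + d 2) (c := d 0 + 2 * f 1) (by omega) (by omega)
      norm_num
      linarith
    · simp only [Nat.mul_zero, zero_add] at hE ⊢
      rw [e2, e1, e0]
      have key : x ^ d 1 * x ^ d 0 - x ^ (2 * f 0) * 1 = x ^ (d 0 + d 1) - x ^ (2 * f 0) := by ring
      rw [key]
      obtain ⟨s1, s2⟩ := twoBlock_sign hx (a := d 0 + d 1) (b := 2 * f 0) hE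
      refine ⟨fun h1 => ?_, fun h1 => ?_⟩
      · simpa using s1 h1
      · have := s2 h1; norm_num; linarith
  | succ j ih =>
    obtain ⟨ihF, ihG⟩ := ih
    -- the pieces at level `j`
    refine ⟨fun hB hx1 => ?_, fun hB hE => ?_⟩
    · -- full design of size `3j+6`: split off block `j+1`
      have hBj : ∀ i, i ≤ j → d (3 * i) + d (3 * i + 1) < 2 * f (3 * i) ∧ 2 * f (3 * i + 1) < d (3 * i + 1) + d (3 * i + 2) :=
        fun i hi => hB i (Nat.le_succ_of_le hi)
      have hF := ihF hBj hx1
      have hG := ihG (fun i hi => hBj i hi.le) (hBj j le_rfl).1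
      obtain ⟨hb0, hb1⟩ := hB (j + 1) le_rfl
      have split := eval_unit_split_three d f x (3 * j + 2)
      rw [show 3 * (j + 1) + 3 = 3 * j + 2 + 4 from by ring]
      rw [split]
      have hT : x ^ (d (3 * j + 2 + 1) + d (3 * j + 2 + 2) + d (3 * j + 2 + 3)) - x ^ (2 * f (3 * j + 2 + 1) + d (3 * j + 2 + 3)) -
          x ^ (d (3 * j + 2 + 1) + 2 * f (3 * j + 2 + 2)) < 0 := by
        apply threeBlock_neg hx
        · have := hb0; rw [show 3 * (j + 1) = 3 * j + 2 + 1 from by ring, show 3 * j + 2 + 1 + 1 = 3 * j + 2 + 2 from rfl] at this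
          omega
        · have := hb1; rw [show 3 * (j + 1) + 1 = 3 * j + 2 + 2 from by ring, show 3 * (j + 1) + 2 = 3 * j + 2 + 3 from by ring] at this
          omega
      have hR := twoBlock_sign hx (a := 2 * f (3 * j + 2 + 2)) (b := d (3 * j + 2 + 2) + d (3 * j + 2 + 3))
        (by have := hb1; rw [show 3 * (j + 1) + 1 = 3 * j + 2 + 2 from by ring, show 3 * (j + 1) + 2 = 3 * j + 2 + 3 from by ring] at this
            omega)
      have hP : 0 < x ^ (2 * f (3 * j + 2)) := pow_pos hx _
      rw [show 3 * j + 2 + 1 = 3 * j + 3 from rfl]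
      set D3 := (pathDet (fun _ => (1 : ℝ)) d (fun _ => (1 : ℝ)) f (3 * j + 3)).eval x
      set D2 := (pathDet (fun _ => (1 : ℝ)) d (fun _ => (1 : ℝ)) f (3 * j + 2)).eval x
      set T := x ^ (d (3 * j + 3) + d (3 * j + 2 + 2) + d (3 * j + 2 + 3)) - x ^ (2 * f (3 * j + 3) + d (3 * j + 2 + 3)) -
          x ^ (d (3 * j + 3) + 2 * f (3 * j + 2 + 2)) with hTdef
      set R := x ^ (d (3 * j + 2 + 2) + d (3 * j + 2 + 3)) - x ^ (2 * f (3 * j + 2 + 2)) with hRdef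
      have key : (-1 : ℝ) ^ (j + 1 + 1) * (T * D3 - x ^ (2 * f (3 * j + 2)) * R * D2) =
          (-T) * ((-1 : ℝ) ^ (j + 1) * D3) + x ^ (2 * f (3 * j + 2)) * R * ((-1 : ℝ) ^ (j + 1) * D2) := by ring
      rw [key]
      rcases lt_or_gt_of_ne hx1 with h1 | h1
      · have hG1 := hG.1 h1
        have hR1 : R < 0 := by have := hR.1 h1; rw [hRdef]; linarith
        have hG2 : (-1 : ℝ) ^ (j + 1) * D2 < 0 := by rw [pow_succ]; nlinarith
        nlinarith [mul_pos (neg_pos.2 hT) hF, mul_pos (mul_pos hP (neg_pos.2 hR1)) (neg_pos.2 hG2)]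
      · have hG1 := hG.2 h1
        have hR1 : 0 < R := by have := hR.2 h1; rw [hRdef]; linarith
        nlinarith [mul_pos (neg_pos.2 hT) hF, mul_pos (mul_pos hP hR1) hG1]
    · -- truncated design of size `3j+5`: split off the ascending 2-block of block `j+1`
      have hBj : ∀ i, i ≤ j → d (3 * i) + d (3 * i + 1) < 2 * f (3 * i) ∧ 2 * f (3 * i + 1) < d (3 * i + 1) + d (3 * i + 2) :=
        fun i hi => hB i (Nat.lt_succ_of_le hi)
      have hG := ihG (fun i hi => hBj i hi.le) (hBj j le_rfl).1
      have split := eval_unit_split_two d f x (3 * j + 2)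
      rw [show 3 * (j + 1) + 2 = 3 * j + 2 + 3 from by ring, split, show 3 * j + 2 + 1 = 3 * j + 3 from rfl]
      have hE' : d (3 * j + 3) + d (3 * j + 2 + 2) < 2 * f (3 * j + 3) := by
        have := hE; rw [show 3 * (j + 1) = 3 * j + 3 from by ring, show 3 * j + 3 + 1 = 3 * j + 2 + 2 from rfl] at this; exact this
      have hR := twoBlock_sign hx hE'
      have hP : 0 < x ^ (2 * f (3 * j + 2) + d (3 * j + 2 + 2)) := pow_pos hx _
      set D3 := (pathDet (fun _ => (1 : ℝ)) d (fun _ => (1 : ℝ)) f (3 * j + 3)).eval x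
      set D2 := (pathDet (fun _ => (1 : ℝ)) d (fun _ => (1 : ℝ)) f (3 * j + 2)).eval x
      set R := x ^ (d (3 * j + 3) + d (3 * j + 2 + 2)) - x ^ (2 * f (3 * j + 3)) with hRdef
      refine ⟨fun h1 => ?_, fun h1 => ?_⟩
      · have hF := ihF hBj h1.ne
        have hG1 := hG.1 h1
        have hR1 : 0 < R := hR.1 h1
        have key : (-1 : ℝ) ^ (j + 1) * (R * D3 - x ^ (2 * f (3 * j + 2) + d (3 * j + 2 + 2)) * D2) =
            R * ((-1 : ℝ) ^ (j + 1) * D3) + x ^ (2 * f (3 * j + 2) + d (3 * j + 2 + 2)) * ((-1 : ℝ) ^ j * D2) := by ring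
        rw [key]
        nlinarith [mul_pos hR1 hF, mul_pos hP hG1]
      · have hF := ihF hBj h1.ne'
        have hG1 := hG.2 h1
        have hR1 : R < 0 := hR.2 h1
        have key : (-1 : ℝ) ^ (j + 1 + 1) * (R * D3 - x ^ (2 * f (3 * j + 2) + d (3 * j + 2 + 2)) * D2) =
            (-R) * ((-1 : ℝ) ^ (j + 1) * D3) + x ^ (2 * f (3 * j + 2) + d (3 * j + 2 + 2)) * ((-1 : ℝ) ^ (j + 1) * D2) := by ring
        rw [key]
        nlinarith [mul_pos (neg_pos.2 hR1) hF, mul_pos hP hG1]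

/-! ### The two laws -/

/-- **TRIPLE-BLOCK EMPTY CHAMBER LAW (all sizes `3(j+1)`).**  If every block `i ≤ j` is descending (`L_{3i} > 0 > L_{3i+1}`, joints arbitrary),
the unit design of size `3j+3` has NO positive determinant zero. [this file] -/
theorem card_posRoots_unit_tripleBlock_eq_zero (j : ℕ)
    (hB : ∀ i, i ≤ j → d (3 * i) + d (3 * i + 1) < 2 * f (3 * i) ∧ 2 * f (3 * i + 1) < d (3 * i + 1) + d (3 * i + 2)) :
    ((pathDet (fun _ => (1 : ℝ)) d (fun _ => (1 : ℝ)) f (3 * j + 3)).roots.toFinset.filter (fun x => 0 < x)).card = 0 := by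
  rw [Finset.card_eq_zero, Finset.eq_empty_iff_forall_notMem]
  intro x hx
  simp only [Finset.mem_filter, Multiset.mem_toFinset, mem_roots', IsRoot.def] at hx
  obtain ⟨⟨-, hr⟩, hx0⟩ := hx
  by_cases hx1 : x = 1
  · subst hx1
    have h := (isRoot_one_unit_iff d f (3 * j + 3)).not.2 (by omega)
    exact h hr
  · have h := (tripleBlock_signs d f j hx0).1 hB hx1
    rw [hr, mul_zero] at h
    exact lt_irrefl _ h

/-- **TRIPLE-BLOCK EXACTLY-ONE LAW (all sizes `3j+2`).**  If blocks `i < j` are descending and `L_{3j} > 0`, the unit design of size `3j+2` has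
EXACTLY ONE positive determinant zero, the resonance `x = 1`. [this file] -/
theorem card_posRoots_unit_tripleBlockTrunc_eq_one (j : ℕ)
    (hB : ∀ i, i < j → d (3 * i) + d (3 * i + 1) < 2 * f (3 * i) ∧ 2 * f (3 * i + 1) < d (3 * i + 1) + d (3 * i + 2))
    (hE : d (3 * j) + d (3 * j + 1) < 2 * f (3 * j)) :
    ((pathDet (fun _ => (1 : ℝ)) d (fun _ => (1 : ℝ)) f (3 * j + 2)).roots.toFinset.filter (fun x => 0 < x)).card = 1 := by
  set P := pathDet (fun _ => (1 : ℝ)) d (fun _ => (1 : ℝ)) f (3 * j + 2) with hP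
  have hP0 : P ≠ 0 := by
    intro h
    have hs := ((tripleBlock_signs d f j (show (0 : ℝ) < 1 / 2 by norm_num)).2 hB hE).1 (by norm_num)
    rw [← hP, h, eval_zero, mul_zero] at hs
    exact lt_irrefl _ hs
  have h1 : (1 : ℝ) ∈ P.roots.toFinset.filter (fun x => 0 < x) := by
    simp only [Finset.mem_filter, Multiset.mem_toFinset, mem_roots']
    exact ⟨⟨hP0, (isRoot_one_unit_iff d f (3 * j + 2)).2 (by omega)⟩, one_pos⟩
  refine le_antisymm (Finset.card_le_one.2 fun x hx y hy => ?_) (Finset.card_pos.2 ⟨1, h1⟩)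
  have key : ∀ z, z ∈ P.roots.toFinset.filter (fun x => 0 < x) → z = 1 := by
    intro z hz
    simp only [Finset.mem_filter, Multiset.mem_toFinset, mem_roots', IsRoot.def] at hz
    obtain ⟨⟨-, hr⟩, hz0⟩ := hz
    by_contra hz1
    have hs := (tripleBlock_signs d f j hz0).2 hB hE
    rcases lt_or_gt_of_ne hz1 with h | h
    · have := hs.1 h; rw [← hP, hr, mul_zero] at this; exact lt_irrefl _ this
    · have := hs.2 h; rw [← hP, hr, mul_zero] at this; exact lt_irrefl _ this
  rw [key x hx, key y hy]

end StaticTridiagonalRealUnit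
end Summit.ValiantsHypothesis.ValiantsHypothesis.Theorems.KPlusLogSqLaw
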